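import Summits.QuantumFields.YangMills.Theorems.UnitScaleTiltHalvingHSupURhoWindowsPrelim
import Literature.MathematicalPhysics.QuantumFieldTheory.Balaban1983to89.B8Prop5ContractionKLevel
import HarnessLib

/-!
# `hP1room` PROGRAMME (LEAD-H BOARD «H = hSupUρ»), row (N05-WINDOWS) — PART 2: the two STRUCTURED top windows (1.103) `B_G·M ≤ α₄/4` and (1.106) `B_G·K ≤ ½`
# in the letters `Mc`∕`Kc` of lit `B8Prop5ContractionKLevel`, and the first-order budgets («drops») of the letters

Route `UnitScaleTilt`, crux K1 child «MinimiserStabilityRegPr» (stmt-QuantumFields-19200), registered stub `stub_halvingStep` (`BirthV10`).  Cell `ym3-torus`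
(HUMAN RULING D-0037: YM₃ on T³ is ladder rung R3 — NOT d = 4, NOT a mass gap, NOT the Clay problem); width seat `ym-t4-w13` g0, row named by LEAD-H ★w5-19200 g5
(2026-08-28 16:39Z).  `--supports stmt-QuantumFields-19200 --as helper`; THEOREMS ONLY (0 `def`, 0 `sorry`); PURE REAL ARITHMETIC, count-neutral; nothing here claims
`hSupU`, `hP1room`, the stub, the crux or the gap.  Consumer: `UnitScaleTiltHalvingHSupURhoWindows`.  Letters as in `…WindowsPrelim` (`V = ℓ³X₀Y·s`, …).

References: T. Bałaban, CMP **99** (1985) 75–102 [Balaban1985RegularSpaces] ((1.99)–(1.103) p.93, (1.106) p.94, Thm 4 p.88, Prop. 3 p.87).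
-/

set_option autoImplicit false

noncomputable section

namespace Summit.QuantumFields.YangMills.Theorems.HalvingHSupURhoWindowsTop

open Literature.MathematicalPhysics.QuantumFieldTheory.Balaban1983to89
open B8Prop5ContractionKLevel (Mc Kc mWc KWc)

/-! ## §1 (1.103) -/

set_option maxHeartbeats 400000 in
/-- **(1.103) `B_G·M ≤ α₄/4`** at `b₁ := α₄/4 + B₀'H(Cb+τ)`, `mE := B₂'(Cb+τ)`, from the structural lower bounds `α₄ ≥ 120ℓ²·BG·BR·cstar`, `α₄ ≥ 9720·BG·BR·B₂'·s`
(the OUTPUT `B₀'`) and the first-order smallness of `cB, α₄, Cb`. [cite: Balaban1985RegularSpaces, (1.103) p.93, (1.99) p.93] (elementary arithmetic; our proof) -/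
theorem top103 {ℓ BG BR B₂' B₀'H Y s α₄ cstar B₀' cB cDA Cb τ : ℝ}
    (hBG : 0 ≤ BG) (hBR : 0 ≤ BR) (hB₂' : 0 ≤ B₂') (hB₀'H : 0 < B₀'H) (hY0 : 0 ≤ Y) (hBGBRY : BG * BR ≤ Y) (hBGBRBY : BG * BR * B₂' ≤ Y)
    (hs0 : 0 < s) (hcs0 : 0 < cstar) (hα₄0 : 0 < α₄) (hcB0 : 0 ≤ cB)
    (hcDA : cDA = 3 * ℓ ^ 2 * cstar) (hα₄E : α₄ = 8 * B₀' * cstar) (hB₀'L2 : 15 * ℓ ^ 2 * BG * BR ≤ B₀') (hB₀'L3 : 3 * BG * BR * B₂' ≤ B₀')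
    (hα₄L : 3240 * B₀' * s ≤ α₄) (hCb : Cb = 579944448 * (120 * cB + α₄) * α₄) (hCb0 : 0 ≤ Cb) (hCbρ' : 2 * B₀'H * Cb ≤ α₄)
    (hQY : 10 ^ 11 * Y * (120 * cB + 8 * α₄) ≤ 1) (hτ0 : 0 ≤ τ) (hτs : τ ≤ 64 * s) (hBτ : B₀'H * τ ≤ α₄ / 4) :
    BG * Mc 3 BR (α₄ / 4 + B₀'H * (Cb + τ)) cB (B₂' * (Cb + τ)) cDA ≤ α₄ / 4 := by
  have hBGBR : 0 ≤ BG * BR := mul_nonneg hBG hBR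
  have hBGBRB : 0 ≤ BG * BR * B₂' := mul_nonneg hBGBR hB₂'
  rw [Mc, mWc]; push_cast
  set b₁ : ℝ := α₄ / 4 + B₀'H * (Cb + τ) with hb₁
  have hb10 : 0 ≤ b₁ := by positivity
  have hb1U : b₁ ≤ α₄ := by rw [hb₁]; linarith only [hCbρ', hBτ]
  have h1 : BG * BR * cDA ≤ α₄ / 40 := by
    rw [hcDA, hα₄E, le_div_iff₀ (by norm_num : (0 : ℝ) < 40)]
    have := mul_le_mul_of_nonneg_right hB₀'L2 hcs0.le
    linarith only [this]
  have h2 : BG * BR * (B₂' * τ) ≤ α₄ / 150 := by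
    rw [le_div_iff₀ (by norm_num : (0 : ℝ) < 150)]
    have e1 := mul_le_mul_of_nonneg_right hB₀'L3 hs0.le
    have e2 := mul_le_mul_of_nonneg_left hτs hBGBRB
    linarith only [e1, e2, hα₄L, mul_nonneg hBGBRB hs0.le]
  have h3 : BG * BR * (B₂' * Cb) ≤ α₄ / 64 := by
    rw [le_div_iff₀ (by norm_num : (0 : ℝ) < 64), hCb]
    have hq : (579944448 : ℝ) * (120 * cB + α₄) ≤ 579944448 * (120 * cB + 8 * α₄) := by linarith only [hα₄0]
    have e1 : BG * BR * B₂' * ((579944448 : ℝ) * (120 * cB + α₄)) ≤ Y * (579944448 * (120 * cB + 8 * α₄)) :=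
      mul_le_mul hBGBRBY hq (by positivity) hY0
    have e3 := mul_le_mul_of_nonneg_right (e1.trans (by linarith only [hQY] : Y * (579944448 * (120 * cB + 8 * α₄)) ≤ 1 / 64)) hα₄0.le
    linarith only [e3]
  have h4 : BG * BR * (3 * (82 * b₁ ^ 2 + 34 * cB * b₁)) ≤ α₄ / 32 := by
    rw [le_div_iff₀ (by norm_num : (0 : ℝ) < 32)]
    have hb : 82 * b₁ ^ 2 + 34 * cB * b₁ ≤ (82 * α₄ + 34 * cB) * α₄ := by
      nlinarith only [mul_le_mul hb1U hb1U hb10 hα₄0.le, mul_le_mul_of_nonneg_left hb1U hcB0]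
    have hY' : 82 * α₄ + 34 * cB ≤ 11 * (120 * cB + 8 * α₄) := by linarith only [hα₄0, hcB0]
    have hc := mul_le_mul hBGBRY hY' (by positivity) hY0
    have e := mul_le_mul_of_nonneg_left hb hBGBR
    have e' := mul_le_mul_of_nonneg_right (hc.trans (by linarith only [hQY] : Y * (11 * (120 * cB + 8 * α₄)) ≤ 1 / 96)) hα₄0.le
    linarith only [e, e']
  have hsum : BG * (BR * (2 * (6 / 5 * cDA + 2 * (B₂' * (Cb + τ)) + 3 * (82 * b₁ ^ 2 + 34 * cB * b₁)))) =
      2 * (6 / 5 * (BG * BR * cDA) + 2 * (BG * BR * (B₂' * Cb)) + 2 * (BG * BR * (B₂' * τ)) + BG * BR * (3 * (82 * b₁ ^ 2 + 34 * cB * b₁))) := by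
    ring
  rw [hsum]; linarith only [h1, h2, h3, h4, hα₄0]

/-! ## §2 (1.106) -/

set_option maxHeartbeats 400000 in
/-- **(1.106) `B_G·K ≤ 1/2`** at `b₁ := α₄/4 + B₀'H(Cb+τ)`, `mE := B₂'(Cb+τ)`, `KE := B₂'·2Cl`, `ℓ₀ = ℓ₁ := 1 + B₀'H·2Cl ≤ 2`: every letter is `≤ const·Y·V`
and `10¹⁸Y⁴V ≤ 1`. [cite: Balaban1985RegularSpaces, (1.106) p.94] (elementary arithmetic; our proof) -/
theorem top106 {BG BR B₂' B₀'H Y s V α₄ cB cDA Cb Cl τ : ℝ}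
    (hBR : 0 ≤ BR) (hB₂' : 0 ≤ B₂') (hB₀'H : 0 < B₀'H) (hY1 : 1 ≤ Y) (hB₂'Y : B₂' ≤ Y) (hBGY : BG ≤ Y) (hBRY : BR ≤ Y)
    (hs0 : 0 < s) (hsV : s ≤ V) (hα₄0 : 0 < α₄) (hα₄1 : α₄ ≤ 1) (hα₄U : α₄ ≤ 2 * 10 ^ 6 * V) (hcB0 : 0 ≤ cB) (hcBU : cB ≤ 3390 * V)
    (hcDA0 : 0 ≤ cDA) (hcDAU : cDA ≤ 10170 * V) (hCb0 : 0 ≤ Cb) (hCbU : Cb ≤ s) (hCbρ' : 2 * B₀'H * Cb ≤ α₄) (hCl0 : 0 ≤ Cl) (hClU : Cl ≤ 10 ^ 16 * V)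
    (hClB : Cl * B₀'H ≤ 1 / 2) (hYV : 10 ^ 18 * Y ^ 4 * V ≤ 1) (hτ0 : 0 ≤ τ) (hτs : τ ≤ 64 * s) (hBτ : B₀'H * τ ≤ α₄ / 4) :
    BG * Kc 3 BR (α₄ / 4 + B₀'H * (Cb + τ)) cB (B₂' * (Cb + τ)) cDA (B₂' * (2 * Cl)) (1 + B₀'H * (2 * Cl)) (1 + B₀'H * (2 * Cl)) ≤ 1 / 2 := by
  have hY0 : 0 ≤ Y := by linarith only [hY1]
  have hV0 : 0 ≤ V := le_trans hs0.le hsV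
  rw [Kc, KWc, mWc]; push_cast
  set b₁ : ℝ := α₄ / 4 + B₀'H * (Cb + τ) with hb₁
  set mE : ℝ := B₂' * (Cb + τ) with hmE
  set l₀ : ℝ := 1 + B₀'H * (2 * Cl) with hl₀
  set M : ℝ := 6 / 5 * cDA + 2 * mE + 3 * (82 * b₁ ^ 2 + 34 * cB * b₁) with hM
  have hb10 : 0 ≤ b₁ := by positivity
  have hb1U : b₁ ≤ α₄ := by rw [hb₁]; linarith only [hCbρ', hBτ]
  have hl₀0 : 0 ≤ l₀ := by positivity
  have hl₀2 : l₀ ≤ 2 := by rw [hl₀]; linarith only [hClB]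
  have hmE0 : 0 ≤ mE := by positivity
  have hmEV : mE ≤ 65 * Y * V := by
    have e := mul_le_mul hB₂'Y (by linarith only [hCbU, hτs, hsV] : Cb + τ ≤ 65 * V) (by positivity) hY0
    rw [hmE]; linarith only [e]
  have hb1V : b₁ ≤ 2 * 10 ^ 6 * V := hb1U.trans hα₄U
  have hb1sq : b₁ ^ 2 ≤ 2 * 10 ^ 6 * V := by nlinarith only [hb10, hb1U, hα₄1, hb1V]
  have hcBb : cB * b₁ ≤ 3390 * V := by
    have e := mul_le_mul hcBU (hb1U.trans hα₄1) hb10 (by positivity)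
    linarith only [e]
  have hKEV : B₂' * (2 * Cl) ≤ 2 * 10 ^ 16 * Y * V := by
    have e := mul_le_mul hB₂'Y hClU hCl0 hY0
    linarith only [e]
  have hYV1 : V ≤ Y * V := by
    have e := mul_nonneg (sub_nonneg.mpr hY1) hV0
    linarith only [e]
  have hM0 : 0 ≤ M := by positivity
  have hMU : M ≤ 5 * 10 ^ 8 * Y * V := by rw [hM]; linarith only [hcDAU, hmEV, hb1sq, hcBb, hYV1, hV0]
  have e1 := mul_le_mul hcDAU hl₀2 hl₀0 (by positivity)
  have e2 := mul_le_mul hmEV hl₀2 hl₀0 (by positivity)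
  have e3 := mul_le_mul hb1V hl₀2 hl₀0 (by positivity)
  have e4 := mul_le_mul hb1sq hl₀2 hl₀0 (by positivity)
  have e5 := mul_le_mul hcBU hl₀2 hl₀0 (by positivity)
  have e6 := mul_le_mul hcBb hl₀2 hl₀0 (by positivity)
  have hKW : 18 * cDA * l₀ + 2 * (B₂' * (2 * Cl)) + 10 * mE * l₀ +
      3 * (438 * b₁ * l₀ + 1968 * b₁ ^ 2 * l₀ + 68 * cB * l₀ + 808 * cB * b₁ * l₀) ≤ 5 * 10 ^ 16 * Y * V := by
    linarith only [e1, e2, e3, e4, e5, e6, hKEV, hYV1, hV0]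
  have hin : 10 * l₀ * (BR * (2 * M)) ≤ 2 * 10 ^ 10 * Y ^ 2 * V := by
    have f1 := mul_le_mul hBRY (mul_le_mul_of_nonneg_left hMU zero_le_two) (by positivity) hY0
    have f2 := mul_le_mul hl₀2 f1 (by positivity) zero_le_two
    linarith only [f2]
  have hY2 : Y * V ≤ Y ^ 2 * V := by
    have e := mul_le_mul_of_nonneg_right hY1 (by positivity : (0 : ℝ) ≤ Y * V)
    linarith only [e]
  have hinner : 18 * cDA * l₀ + 2 * (B₂' * (2 * Cl)) + 10 * mE * l₀ +
      3 * (438 * b₁ * l₀ + 1968 * b₁ ^ 2 * l₀ + 68 * cB * l₀ + 808 * cB * b₁ * l₀) + 10 * l₀ * (BR * (2 * M)) ≤ 6 * 10 ^ 16 * Y ^ 2 * V := by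
    linarith only [hKW, hin, hY2, hV0, hYV1, (by positivity : (0 : ℝ) ≤ Y ^ 2 * V)]
  have h0 : 0 ≤ 18 * cDA * l₀ + 2 * (B₂' * (2 * Cl)) + 10 * mE * l₀ +
      3 * (438 * b₁ * l₀ + 1968 * b₁ ^ 2 * l₀ + 68 * cB * l₀ + 808 * cB * b₁ * l₀) + 10 * l₀ * (BR * (2 * M)) := by positivity
  have htot := mul_le_mul hBGY (mul_le_mul hBRY (mul_le_mul_of_nonneg_left hinner zero_le_two) (by positivity) hY0) (by positivity) hY0
  have hY4 : Y * (Y * (2 * (6 * 10 ^ 16 * Y ^ 2 * V))) ≤ 1 / 2 := by nlinarith only [hYV, hY0]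
  exact htot.trans hY4

/-! ## §3 First-order budgets («drops») -/

set_option maxHeartbeats 400000 in
/-- **Drops**: the first-order budgets every scalar window reads, from the monomial budgets and the sizes.
[cite: Balaban1985RegularSpaces, Thm 4 p.88, Prop. 3 p.87, Prop. 5 p.94] (elementary arithmetic; our proof) -/
theorem drops {ℓ B₀ X₀ Y c cB9 s ε₀ α₁ cstar α₄ cB Q : ℝ}
    (hℓ1 : 1 ≤ ℓ) (hX₀1 : 1 ≤ X₀) (hB₀X : B₀ ≤ X₀) (hY1 : 1 ≤ Y) (hc : c = cB9⁻¹) (hcB9 : 0 < cB9)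
    (hs0 : 0 < s) (hε₀ : 0 < ε₀) (hεs : ε₀ ≤ s)
    (hW1 : 10 ^ 8 * ℓ ^ 2 * s ≤ 1) (hW3 : 10 ^ 12 * ℓ ^ 3 * X₀ ^ 2 * Y * (1 + c) * s ≤ 1) (hW4 : 10 ^ 19 * ℓ ^ 4 * X₀ ^ 2 * Y ^ 2 * s ≤ 1)
    (hcs0 : 0 < cstar) (hcsL : 405 * s ≤ cstar) (hcsU : cstar ≤ 3390 * ℓ * X₀ * s) (hα₁U : α₁ ≤ 225 * X₀ * s) (hcB0 : 0 ≤ cB) (hα₄0 : 0 < α₄)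
    (hQ : Q = ε₀ + 120 * cB + 8 * α₄) (hQU : Q ≤ 2 * 10 ^ 7 * (ℓ ^ 3 * X₀ * Y * s)) :
    10 ^ 11 * Q ≤ 1 ∧ 10 ^ 11 * ℓ * Q ≤ 1 ∧ 10 ^ 11 * Y * Q ≤ 1 ∧ 10 ^ 11 * X₀ * Q ≤ 1 ∧
      10 ^ 8 * ℓ ^ 2 * cstar ≤ 1 ∧ 10 ^ 8 * ℓ * cstar ≤ 1 ∧ 10 ^ 8 * cstar ≤ 1 ∧ 10 ^ 8 * B₀ * cstar ≤ 1 ∧ cstar ≤ cB9 ∧ ε₀ ≤ cB9 ∧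
      10 ^ 8 * ℓ ^ 2 * ε₀ ≤ 1 ∧ 10 ^ 8 * ε₀ ≤ 1 ∧ 10 ^ 4 * ℓ * X₀ * s ≤ 1 ∧ 10 ^ 4 * s ≤ 1 ∧ 3 * ℓ * α₁ ≤ 1 / 8 ∧
      Y * (ℓ ^ 3 * X₀ * Y * s) ≤ 1 / 10 ^ 19 ∧ 10 ^ 19 * ℓ * X₀ * Y * (ℓ ^ 3 * X₀ * Y * s) ≤ 1 := by
  have hℓ0 : 0 ≤ ℓ := by linarith only [hℓ1]
  have hX₀0 : 0 ≤ X₀ := by linarith only [hX₀1]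
  have hY0 : 0 ≤ Y := by linarith only [hY1]
  have hc0 : 0 ≤ c := by rw [hc]; positivity
  have hc1 : 1 ≤ 1 + c := by linarith only [hc0]
  have hQ0 : 0 ≤ Q := by rw [hQ]; positivity
  have hℓX : 1 ≤ ℓ * X₀ := one_le_mul_of_one_le_of_one_le hℓ1 hX₀1
  have hℓY : 1 ≤ ℓ * Y := one_le_mul_of_one_le_of_one_le hℓ1 hY1
  have hXY : 1 ≤ X₀ * Y := one_le_mul_of_one_le_of_one_le hX₀1 hY1
  have hℓXY : 1 ≤ ℓ * X₀ * Y := one_le_mul_of_one_le_of_one_le hℓX hY1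
  have hℓ2 : 1 ≤ ℓ ^ 2 := one_le_pow₀ hℓ1
  have hℓℓ : ℓ ≤ ℓ ^ 2 := by nlinarith only [hℓ1]
  have hℓ2X : 1 ≤ ℓ ^ 2 * X₀ := one_le_mul_of_one_le_of_one_le hℓ2 hX₀1
  have hX1c : 1 ≤ X₀ * (1 + c) := one_le_mul_of_one_le_of_one_le hX₀1 hc1
  have hℓ2c : 1 ≤ ℓ ^ 2 * (1 + c) := one_le_mul_of_one_le_of_one_le hℓ2 hc1
  have hbig : 1 ≤ ℓ ^ 2 * X₀ * Y * (1 + c) := one_le_mul_of_one_le_of_one_le (one_le_mul_of_one_le_of_one_le hℓ2X hY1) hc1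
  -- the `Q` master and its drops
  have hQm : 10 ^ 11 * ℓ * X₀ * Y * Q ≤ 1 := by
    have e := mul_le_mul_of_nonneg_left hQU (by positivity : (0 : ℝ) ≤ ℓ * X₀ * Y)
    linarith only [e, hW4]
  have hQ11 : 10 ^ 11 * Q ≤ 1 := by
    have f := mul_nonneg (sub_nonneg.mpr hℓXY) hQ0; linarith only [hQm, f]
  have hQℓ : 10 ^ 11 * ℓ * Q ≤ 1 := by
    have f := mul_nonneg (sub_nonneg.mpr hXY) (by positivity : (0 : ℝ) ≤ ℓ * Q); linarith only [hQm, f]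
  have hQY : 10 ^ 11 * Y * Q ≤ 1 := by
    have f := mul_nonneg (sub_nonneg.mpr hℓX) (by positivity : (0 : ℝ) ≤ Y * Q); linarith only [hQm, f]
  have hQX : 10 ^ 11 * X₀ * Q ≤ 1 := by
    have f := mul_nonneg (sub_nonneg.mpr hℓY) (by positivity : (0 : ℝ) ≤ X₀ * Q); linarith only [hQm, f]
  -- the `cstar` master and its drops
  have hcsm : 10 ^ 8 * ℓ ^ 2 * X₀ * (1 + c) * cstar ≤ 1 := by
    have e1 := mul_le_mul_of_nonneg_left hcsU (by positivity : (0 : ℝ) ≤ ℓ ^ 2 * X₀ * (1 + c))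
    have e2 := mul_nonneg (sub_nonneg.mpr hY1) (by positivity : (0 : ℝ) ≤ ℓ ^ 3 * X₀ ^ 2 * (1 + c) * s)
    linarith only [e1, e2, hW3]
  have hcsℓ2 : 10 ^ 8 * ℓ ^ 2 * cstar ≤ 1 := by
    have f := mul_nonneg (sub_nonneg.mpr hX1c) (by positivity : (0 : ℝ) ≤ ℓ ^ 2 * cstar); linarith only [hcsm, f]
  have hcsℓ1 : 10 ^ 8 * ℓ * cstar ≤ 1 := by
    have f := mul_le_mul_of_nonneg_right hℓℓ hcs0.le; linarith only [hcsℓ2, f]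
  have hcs8 : 10 ^ 8 * cstar ≤ 1 := by
    have f := mul_nonneg (sub_nonneg.mpr hℓ1) hcs0.le; linarith only [hcsℓ1, f]
  have hcsB₀ : 10 ^ 8 * B₀ * cstar ≤ 1 := by
    have f1 := mul_le_mul_of_nonneg_right hB₀X hcs0.le
    have f2 := mul_nonneg (sub_nonneg.mpr hℓ2c) (by positivity : (0 : ℝ) ≤ X₀ * cstar)
    linarith only [hcsm, f1, f2]
  have hcs9 : cstar ≤ cB9 := by
    have f1 := mul_nonneg (sub_nonneg.mpr hℓ2X) (by positivity : (0 : ℝ) ≤ (1 + c) * cstar)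
    have f2 : c * cstar ≤ 1 := by
      have f3 := mul_nonneg hcs0.le (show (0 : ℝ) ≤ 1 from zero_le_one)
      linarith only [hcsm, f1, hcs0, hc0]
    rw [hc] at f2
    have f4 := mul_le_mul_of_nonneg_left f2 hcB9.le
    rw [← mul_assoc, mul_inv_cancel₀ hcB9.ne', one_mul, mul_one] at f4
    exact f4
  have hε8ℓ : 10 ^ 8 * ℓ ^ 2 * ε₀ ≤ 1 := by
    have f := mul_le_mul_of_nonneg_left hεs (by positivity : (0 : ℝ) ≤ ℓ ^ 2); linarith only [hW1, f]
  have hε8 : 10 ^ 8 * ε₀ ≤ 1 := by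
    have f := mul_nonneg (sub_nonneg.mpr hℓ2) hε₀.le; linarith only [hε8ℓ, f]
  have hα9 : ε₀ ≤ cB9 := by linarith only [hεs, hcsL, hcs9, hcs0, hs0]
  have hℓXs : 10 ^ 4 * ℓ * X₀ * s ≤ 1 := by
    have f := mul_nonneg (sub_nonneg.mpr hbig) (by positivity : (0 : ℝ) ≤ ℓ * X₀ * s); linarith only [hW3, f]
  have hs4 : 10 ^ 4 * s ≤ 1 := by
    have f := mul_nonneg (sub_nonneg.mpr hℓX) hs0.le; linarith only [hℓXs, f]
  have hα₁ : 3 * ℓ * α₁ ≤ 1 / 8 := by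
    have f := mul_le_mul_of_nonneg_left hα₁U hℓ0; linarith only [hℓXs, f]
  have hYV : Y * (ℓ ^ 3 * X₀ * Y * s) ≤ 1 / 10 ^ 19 := by
    rw [le_div_iff₀ (by norm_num : (0 : ℝ) < 10 ^ 19)]
    have f := mul_nonneg (sub_nonneg.mpr hℓX) (by positivity : (0 : ℝ) ≤ ℓ ^ 3 * X₀ * Y ^ 2 * s)
    linarith only [hW4, f]
  have hYV19 : 10 ^ 19 * ℓ * X₀ * Y * (ℓ ^ 3 * X₀ * Y * s) ≤ 1 := by linarith only [hW4]
  exact ⟨hQ11, hQℓ, hQY, hQX, hcsℓ2, hcsℓ1, hcs8, hcsB₀, hcs9, hα9, hε8ℓ, hε8, hℓXs, hs4, hα₁, hYV, hYV19⟩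

end Summit.QuantumFields.YangMills.Theorems.HalvingHSupURhoWindowsTop

end
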